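import Summits.QuantumAdvantage.AdviceFreeQNC0.WalkTube
import Summits.QuantumAdvantage.AdviceFreeQNC0.JointResidueElimination
import HarnessLib

/-!
# Cell qa-qnc0 (rung F-Q1, route `RingFrame`, crux α `RingToElim`): THE TUBE BOUND — T11-3
# `TubeBound` by the rank form + Nie–Wang, and T11-6 `TubePlan` (qn-p2 ROUND-11, asks P11-A/D)

Planner qa-qnc0-p2's ROUND-11 (`HOME/qa-qnc0-p2/ROUND-11.md`, typed `Sketch11.lean`; statements in
`WalkTube.lean`).  PROVED here:

* `TubeRank.hilbertFn_far_le_card_failSet` — **the rank form of T11-1**: for `f ∈ M_D(P)`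
  (`fullSpan m D`) and every `D'`, `h_{D'}(FAR_{D'+D}) ≤ #FAIL(f)`, where `h` is the affine Hilbert
  function `Smolensky.hilbertFn` (dimension of `(lowDeg D')|_Y`).  Mechanism: the twisted-trace
  transform `Θ_Y(Q)(a) = [a ∈ Y]·tr(ω²·ω^{2a([m])}·L_a(Q))` (`TubeRank.theta`, an `𝔽₂`-linear map into
  the `𝔽₂`-module of `𝔽₄`-valued functions; the planner's `π∘Ψ` read through `tr(ω²·)`), with
  `Θ(u^S) = Σ_{T⊆S, |S∖T| ≢ 2 (3)} e_T|_Y` (`theta_mono`, from `twist_mul_Lfun_monoF`, `τ_a(i) = [a i] + ω²`,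
  `Finset.prod_add`, `tr_omega_pow`) — unitriangular, so `(lowDeg D')|_Y ⊆ im Θ` (`eY_mem_range`,
  `map_iota_le_range`); and `ker(·|_FAIL) ≤ ker Θ_FAR` on `lowDeg D'` by the tree's
  `Lfun_algebraMap_eq_zero_of_vanish` (a polynomial vanishing on the fail set has no far frequencies);
  rank–nullity (`LinearMap.finrank_range_add_finrank_ker`) gives `h ≤ rank Θ ≤ rank(·|_FAIL) ≤ #FAIL`.
* **`tubeBound : TubeBound`** — with the tree's NIE–WANG inequality
  `Smolensky.numMonomials_mul_card_le_two_pow_mul_hilbertFn` (`N_{D'}·|Y| ≤ 2^m·h_{D'}(Y)` for every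
  `Y`): `|FAR_{D'+D}|·N_{D'}(m) ≤ 2^m·#FAIL(f)`.  (T11-1's ball minor and T11-2's averaging are bypassed.)
* **`tubePlan : TubePlan`** (T11-6) and `walkHardAll_of_tubeMass_of_binomTailLower :
  TubeMass → BinomTailLower → WalkHardAll`: `C₁, m₀` from `TubeMass`, `c, m₁` from `BinomTailLower` at
  `C₁+1`, `θ = 1 − c/2`, `(log₂ n)^C ≤ ⌊√n⌋` eventually (`logPow_le_natSqrt`), `D' = n/2 − C₁⌊√n⌋ − D`,
  `stratFun_mem_fullSpan` + `tr_stratFun` (`#WIN + #FAIL = 2ⁿ`).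

WHAT THIS IS NOT: `TubeMass` and `BinomTailLower` are hypotheses here (separate files); the closing of
stmt-QuantumAdvantage-19119 happens in `QuantumAdvantage/Theorems/` only; separation NOT moved by this
file alone.
-/

noncomputable section

open Classical

namespace Summit.QuantumAdvantage.AdviceFreeQNC0

open Finset
open Literature.Computability.MetaComplexity Literature.Computability.MetaComplexity.Smolensky
open F4

/-! ## The rank form: `h_{D'}(FAR) ≤ #FAIL`, and the tube bound via Nie–Wang -/

namespace TubeRank

open Module

variable {m : ℕ}

/-- `𝔽₄`-valued functions on patterns, an `𝔽₂`-module. -/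
abbrev M4 (m : ℕ) : Type := (Fin m → Bool) → F4

/-- Reading an `𝔽₂`-valued function in `𝔽₄` (an injective `𝔽₂`-linear map). -/
def iota : CubeFn (ZMod 2) m →ₗ[ZMod 2] M4 m where
  toFun Q := fun a => algebraMap (ZMod 2) F4 (Q a)
  map_add' Q R := by funext a; simp
  map_smul' c Q := by funext a; simp [Algebra.smul_def]

/-- Pointwise formula for `iota`. -/
theorem iota_apply (Q : CubeFn (ZMod 2) m) (a : Fin m → Bool) :
    iota Q a = algebraMap (ZMod 2) F4 (Q a) := rfl

/-- `iota` is injective. -/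
theorem iota_injective : Function.Injective (iota (m := m)) := by
  haveI := F4.nontrivial
  intro Q R h
  funext a
  exact (algebraMap (ZMod 2) F4).injective (by rw [← iota_apply, ← iota_apply, h])

/-- `tr (c · x) = c · tr x` for `c ∈ 𝔽₂`. -/
theorem tr_algebraMap_mul (c : ZMod 2) (x : F4) :
    tr (algebraMap (ZMod 2) F4 c * x) = algebraMap (ZMod 2) F4 c * tr x := by
  have hc : c = 0 ∨ c = 1 := by
    fin_cases c
    · exact Or.inl rfl
    · exact Or.inr rfl
  rcases hc with rfl | rfl
  · rw [map_zero, zero_mul, zero_mul, tr_zero]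
  · rw [map_one, one_mul, one_mul]

/-- **The twisted-trace transform** `Θ_Y(Q)(a) = [a ∈ Y] · tr(ω² · ω^{2a([m])} · L_a(Q))`, an
`𝔽₂`-linear map from `𝔽₂`-polynomials to `𝔽₄`-valued functions on patterns (the `1`-coordinate of the
planner's `Ψ`, read through `tr(ω²·)`: `1 ↦ 1`, `ω ↦ 0`, `ω² ↦ 1`). -/
def theta (Y : Finset (Fin m → Bool)) : CubeFn (ZMod 2) m →ₗ[ZMod 2] M4 m where
  toFun Q := fun a => if a ∈ Y then
    tr (ω ^ 2 * (ω ^ (2 * lettSum univ a) * Lfun a (fun u => algebraMap (ZMod 2) F4 (Q u)))) else 0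
  map_add' Q R := by
    funext a
    by_cases ha : a ∈ Y
    · simp only [if_pos ha, Pi.add_apply, map_add]
      rw [Lfun_add_apply a (fun u => algebraMap (ZMod 2) F4 (Q u)) (fun u => algebraMap (ZMod 2) F4 (R u)),
        mul_add, mul_add, tr_add]
    · simp only [if_neg ha, Pi.add_apply, add_zero]
  map_smul' c Q := by
    funext a
    by_cases ha : a ∈ Y
    · simp only [if_pos ha, Pi.smul_apply, smul_eq_mul, map_mul, RingHom.id_apply]
      rw [Lfun_mul_apply, mul_left_comm (ω ^ (2 * lettSum univ a)), mul_left_comm (ω ^ 2),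
        tr_algebraMap_mul, Algebra.smul_def]
    · simp only [if_neg ha, Pi.smul_apply, smul_zero, RingHom.id_apply]

/-- Pointwise formula for `theta`. -/
theorem theta_apply (Y : Finset (Fin m → Bool)) (Q : CubeFn (ZMod 2) m) (a : Fin m → Bool) :
    theta Y Q a = if a ∈ Y then
      tr (ω ^ 2 * (ω ^ (2 * lettSum univ a) * Lfun a (fun u => algebraMap (ZMod 2) F4 (Q u)))) else 0 :=
  rfl

/-- the subset indicators `e_T(a) = [T ⊆ supp a]` restricted to `Y`, read in `𝔽₄`. -/
def eY (Y : Finset (Fin m → Bool)) (T : Finset (Fin m)) : M4 m :=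
  fun a => if a ∈ Y then monoF T a else 0

/-- An `𝔽₂`-monomial read in `𝔽₄` is the `𝔽₄`-monomial. -/
theorem algebraMap_mono (S : Finset (Fin m)) (u : Fin m → Bool) :
    algebraMap (ZMod 2) F4 (mono (ZMod 2) S u) = monoF S u := by
  rw [mono_apply, monoF_eq_ite]
  split_ifs <;> simp

/-- `Π_{i∈S} τ_a(i) = Σ_{T⊆S} u^T(a) · ω^{2|S∖T|}` (expand `τ_a(i) = [a i] + ω²`). -/
theorem prod_twist_eq (a : Fin m → Bool) (S : Finset (Fin m)) :
    ∏ i ∈ S, twist a i = ∑ T ∈ S.powerset, monoF T a * (ω ^ 2) ^ (S \ T).card := by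
  have e : ∀ i ∈ S, twist a i = ιF (a i) + ω ^ 2 := by
    intro i _
    unfold twist lett ιF
    cases a i
    · simp
    · simp only [if_true]
      rw [omega_pow_mod, show 2 * 2 % 3 = 1 by norm_num, pow_one, one_add_omega_sq]
  rw [Finset.prod_congr rfl e, Finset.prod_add]
  refine Finset.sum_congr rfl fun T _ => ?_
  rw [Finset.prod_const]
  rfl

/-- `tr (u^T(a) · x) = u^T(a) · tr x` (`u^T(a) ∈ {0,1}`). -/
theorem tr_monoF_mul (T : Finset (Fin m)) (a : Fin m → Bool) (x : F4) :
    tr (monoF T a * x) = monoF T a * tr x := by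
  rw [monoF_eq_ite]
  split_ifs
  · rw [one_mul, one_mul]
  · rw [zero_mul, zero_mul, tr_zero]

/-- `tr(ω² · ω^{2k}) = [k ≢ 2 (mod 3)]`. -/
theorem tr_omega_sq_mul_pow (k : ℕ) : tr (ω ^ 2 * (ω ^ 2) ^ k) = if k % 3 = 2 then 0 else 1 := by
  rw [← pow_succ', ← pow_mul, tr_omega_pow]
  by_cases h : k % 3 = 2
  · rw [if_pos (by omega), if_pos h]
  · rw [if_neg (by omega), if_neg h]

/-- **The transform of a monomial is unitriangular in the subset indicators**:
`Θ_Y(u^S) = Σ_{T ⊆ S, |S∖T| ≢ 2 (mod 3)} e_T|_Y`. -/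
theorem theta_mono (Y : Finset (Fin m → Bool)) (S : Finset (Fin m)) :
    theta Y (mono (ZMod 2) S) =
      ∑ T ∈ S.powerset.filter (fun T => (S \ T).card % 3 ≠ 2), eY Y T := by
  funext a
  rw [Finset.sum_apply, theta_apply]
  by_cases ha : a ∈ Y
  · rw [if_pos ha]
    have e1 : (fun u => algebraMap (ZMod 2) F4 (mono (ZMod 2) S u)) = monoF S :=
      funext (algebraMap_mono S)
    rw [e1, twist_mul_Lfun_monoF, prod_twist_eq, Finset.mul_sum, tr_sum, Finset.sum_filter]
    refine Finset.sum_congr rfl fun T _ => ?_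
    rw [mul_left_comm, tr_monoF_mul, tr_omega_sq_mul_pow]
    unfold eY
    rw [if_pos ha]
    by_cases h : (S \ T).card % 3 = 2
    · rw [if_pos h, mul_zero, if_neg (not_not.2 h)]
    · rw [if_neg h, mul_one, if_pos h]
  · rw [if_neg ha]
    symm
    exact Finset.sum_eq_zero fun T _ => by unfold eY; rw [if_neg ha]

/-- **Inversion**: every subset indicator `e_T|_Y` with `|T| ≤ D'` is the transform of some
`𝔽₂`-polynomial of degree `≤ D'` (strong induction on `|T|` along the unitriangular system). -/
theorem eY_mem_range (Y : Finset (Fin m → Bool)) (D' : ℕ) (S : Finset (Fin m)) (hSD : S.card ≤ D') :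
    eY Y S ∈ LinearMap.range ((theta Y).domRestrict (lowDeg (ZMod 2) m D')) := by
  induction' hk : S.card using Nat.strong_induction_on with k ih generalizing S
  have hmono : theta Y (mono (ZMod 2) S) ∈
      LinearMap.range ((theta Y).domRestrict (lowDeg (ZMod 2) m D')) :=
    ⟨⟨mono (ZMod 2) S, mono_mem_lowDeg hSD⟩, rfl⟩
  rw [theta_mono] at hmono
  set F := S.powerset.filter (fun T => (S \ T).card % 3 ≠ 2) with hF
  have hSF : S ∈ F := by
    rw [hF, mem_filter]
    exact ⟨mem_powerset_self S, by simp⟩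
  rw [← add_sum_erase F _ hSF] at hmono
  have hrest : ∑ T ∈ F.erase S, eY Y T ∈
      LinearMap.range ((theta Y).domRestrict (lowDeg (ZMod 2) m D')) := by
    refine Submodule.sum_mem _ fun T hT => ?_
    have hT' := mem_erase.1 hT
    have hTS : T ⊆ S := mem_powerset.1 (mem_filter.1 hT'.2).1
    have hlt : T.card < S.card := card_lt_card (Finset.ssubset_iff_subset_ne.2 ⟨hTS, hT'.1⟩)
    exact ih T.card (hk ▸ hlt) T (by omega) rfl
  have h := Submodule.sub_mem _ hmono hrest
  rwa [add_sub_cancel_right] at h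

/-- Pointwise formula for the restriction map `projOn`. -/
theorem projOn_apply' (Y : Finset (Fin m → Bool)) (v : CubeFn (ZMod 2) m) (x : Fin m → Bool) :
    projOn (ZMod 2) Y v x = if x ∈ Y then v x else 0 :=
  rfl

/-- **The transform sees all of `(lowDeg D')|_Y`**: the image under `iota` of the restriction of
`lowDeg D'` to `Y` lies in the range of `Θ_Y` on `lowDeg D'`. -/
theorem map_iota_le_range (Y : Finset (Fin m → Bool)) (D' : ℕ) :
    ((lowDeg (ZMod 2) m D').map (projOn (ZMod 2) Y)).map iota ≤
      LinearMap.range ((theta Y).domRestrict (lowDeg (ZMod 2) m D')) := by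
  rw [← Submodule.map_comp, lowDeg_eq_span, Submodule.map_span, Submodule.span_le]
  rintro _ ⟨_, ⟨⟨S, hS⟩, rfl⟩, rfl⟩
  have e : (iota.comp (projOn (ZMod 2) Y)) (mono (ZMod 2) S) = eY Y S := by
    funext a
    rw [LinearMap.comp_apply, iota_apply, projOn_apply']
    unfold eY
    by_cases ha : a ∈ Y
    · rw [if_pos ha, if_pos ha, algebraMap_mono]
    · rw [if_neg ha, if_neg ha, map_zero]
  rw [e]
  exact eY_mem_range Y D' S hS

/-- **THE RANK FORM (T11-1 without the ball): `h_{D'}(FAR_{D'+D}) ≤ #FAIL(f)`** for every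
`f ∈ M_D(P)`.  The restriction `Q ↦ Q|_FAIL` on `lowDeg D'` has kernel inside `ker Θ_FAR`
(`Lfun_algebraMap_eq_zero_of_vanish`: a polynomial vanishing on the fail set has no far frequencies),
so `h_{D'}(FAR) = dim (lowDeg D')|_FAR ≤ rank Θ_FAR ≤ rank (·|_FAIL) ≤ #FAIL`. -/
theorem hilbertFn_far_le_card_failSet {D : ℕ} {f : (Fin m → Bool) → F4} (hf : f ∈ fullSpan m D)
    (D' : ℕ) : hilbertFn (ZMod 2) (farSet m (D' + D)) D' ≤ (failSetOf f).card := by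
  set Y := farSet m (D' + D) with hY
  set E := failSetOf f with hE
  set V := lowDeg (ZMod 2) m D' with hV
  set Θ : V →ₗ[ZMod 2] M4 m := (theta Y).domRestrict V with hΘ
  set R : V →ₗ[ZMod 2] (↥E → ZMod 2) :=
    (LinearMap.funLeft (ZMod 2) (ZMod 2) (fun u : ↥E => (u.1 : Fin m → Bool))).comp V.subtype with hR
  have hker : LinearMap.ker R ≤ LinearMap.ker Θ := by
    intro Q hQ
    rw [LinearMap.mem_ker] at hQ ⊢
    have hvan : ∀ u, tr (f u) ≠ 1 → (Q : CubeFn (ZMod 2) m) u = 0 := by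
      intro u hu
      have hu' : u ∈ E := by rw [hE]; exact mem_filter.2 ⟨mem_univ _, hu⟩
      have h := congrFun hQ ⟨u, hu'⟩
      simpa [hR, LinearMap.funLeft_apply] using h
    rw [hΘ, LinearMap.domRestrict_apply]
    funext a
    rw [theta_apply, Pi.zero_apply]
    by_cases ha : a ∈ Y
    · rw [if_pos ha]
      have ha' := (mem_filter.1 (hY ▸ ha)).2
      rw [Lfun_algebraMap_eq_zero_of_vanish hf Q.2 hvan ha'.1 ha'.2, mul_zero, mul_zero, tr_zero]
    · rw [if_neg ha]
  have h1 : finrank (ZMod 2) (LinearMap.range Θ) ≤ finrank (ZMod 2) (LinearMap.range R) := by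
    have e1 := LinearMap.finrank_range_add_finrank_ker Θ
    have e2 := LinearMap.finrank_range_add_finrank_ker R
    have e3 := Submodule.finrank_mono hker
    omega
  have h2 : finrank (ZMod 2) (LinearMap.range R) ≤ E.card := by
    calc finrank (ZMod 2) (LinearMap.range R) ≤ finrank (ZMod 2) (↥E → ZMod 2) :=
          Submodule.finrank_le _
      _ = E.card := by rw [Module.finrank_fintype_fun_eq_card, Fintype.card_coe]
  have h3 : hilbertFn (ZMod 2) Y D' ≤ finrank (ZMod 2) (LinearMap.range Θ) := by
    unfold hilbertFn
    rw [LinearEquiv.finrank_eq (Submodule.equivMapOfInjective iota iota_injective _)]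
    exact Submodule.finrank_mono (map_iota_le_range Y D')
  omega

end TubeRank

/-- **T11-3 `TubeBound` — PROVED** (ROUND-11's T11-1 + T11-2 replaced by the rank form
`TubeRank.hilbertFn_far_le_card_failSet` and the tree's Nie–Wang inequality
`Smolensky.numMonomials_mul_card_le_two_pow_mul_hilbertFn`): for every full strategy `f ∈ M_D(P)`
and every test degree `D'`, `|FAR_{D'+D}| · N_{D'}(m) ≤ 2^m · #FAIL(f)`. -/
theorem tubeBound : TubeBound := by
  intro m D D' f hf
  have h1 := numMonomials_mul_card_le_two_pow_mul_hilbertFn (F := ZMod 2) (farSet m (D' + D)) D'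
  have h2 := TubeRank.hilbertFn_far_le_card_failSet hf D'
  calc (farSet m (D' + D)).card * numMonomials m D'
      = numMonomials m D' * (farSet m (D' + D)).card := Nat.mul_comm _ _
    _ ≤ 2 ^ m * hilbertFn (ZMod 2) (farSet m (D' + D)) D' := h1
    _ ≤ 2 ^ m * (failSetOf f).card := Nat.mul_le_mul_left _ h2


/-! ## T11-6 `TubePlan`: the assembly -/

namespace TubePlanProof

/-- `(log₂ n)^C ≤ ⌊√n⌋` for all large `n`. -/
theorem logPow_le_natSqrt (C : ℕ) : ∃ n₀ : ℕ, ∀ n ≥ n₀, (Nat.log 2 n) ^ C ≤ Nat.sqrt n := by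
  obtain ⟨n₀, hn₀⟩ := logPow_le_sqrt' C (c₀ := 1 / 2) (by norm_num)
  refine ⟨max n₀ 4, fun n hn => ?_⟩
  have h1 := hn₀ n (le_trans (le_max_left _ _) hn)
  have h4 : (4 : ℝ) ≤ n := by exact_mod_cast le_trans (le_max_right _ _) hn
  have hs4 : Real.sqrt 4 = 2 := by
    rw [show (4 : ℝ) = 2 ^ 2 by norm_num, Real.sqrt_sq (by norm_num)]
  have hs2 : (2 : ℝ) ≤ Real.sqrt n := by rw [← hs4]; exact Real.sqrt_le_sqrt h4
  have h2 : Real.sqrt (n : ℝ) ≤ Nat.sqrt n + 1 := Real.real_sqrt_le_nat_sqrt_succ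
  have h3 : ((Nat.log 2 n ^ C : ℕ) : ℝ) ≤ Nat.sqrt n := by linarith
  exact_mod_cast h3

/-- The fail set of a walk strategy's `𝔽₄`-function is the complement of its win set. -/
theorem card_win_add_card_failSetOf {n : ℕ} (ch : ℕ) (y : Fin (n + 1) → (Fin n → Bool) → Bool) :
    (univ.filter fun u : Fin n → Bool => ringWinU ch y u = true).card +
      (failSetOf (stratFun ch y)).card = 2 ^ n := by
  haveI := F4.nontrivial
  have e : failSetOf (stratFun ch y) = univ.filter fun u : Fin n → Bool => ¬ ringWinU ch y u = true := by
    unfold failSetOf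
    refine filter_congr fun u _ => ?_
    rw [tr_stratFun]
    unfold ιF
    cases ringWinU ch y u <;> simp
  rw [e, card_filter_add_card_filter_not, card_univ, Fintype.card_fun, Fintype.card_bool,
    Fintype.card_fin]

end TubePlanProof

open TubePlanProof in
/-- **T11-6 `TubePlan` — PROVED**: the tube bound, the tube mass and the binomial tail give walk
hardness at EVERY charge and every polylog degree: with `C₁, m₀` from `TubeMass`, `c, m₁` from
`BinomTailLower` at `C₁ + 1`, `θ = 1 − c/2`; for `n` large, `D = (log₂ n)^C ≤ ⌊√n⌋`,
`D' = n/2 − C₁⌊√n⌋ − D`, the walk strategy's function `stratFun ch y ∈ M_D(P)` fails on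
`≥ |FAR_{D'+D}|·N_{D'}/2^n ≥ (c/2)·2^n` inputs. -/
theorem tubePlan : TubePlan := by
  intro hTB hTM hBT
  obtain ⟨C₁, m₀, hmass⟩ := hTM
  obtain ⟨c, hc, m₁, htail⟩ := hBT (C₁ + 1)
  refine ⟨1 - c / 2, by linarith, fun C => ?_⟩
  obtain ⟨n₂, hn₂⟩ := logPow_le_natSqrt C
  refine ⟨max (max m₀ m₁) (max n₂ (4 * (C₁ + 1) ^ 2)), fun n hn ch y hy => ?_⟩
  have hm₀ : m₀ ≤ n := le_trans (le_trans (le_max_left _ _) (le_max_left _ _)) hn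
  have hm₁ : m₁ ≤ n := le_trans (le_trans (le_max_right _ _) (le_max_left _ _)) hn
  have hn₂' : n₂ ≤ n := le_trans (le_trans (le_max_left _ _) (le_max_right _ _)) hn
  have hbig : 4 * (C₁ + 1) ^ 2 ≤ n := le_trans (le_trans (le_max_right _ _) (le_max_right _ _)) hn
  set D := (Nat.log 2 n) ^ C with hD
  set s := Nat.sqrt n with hs
  have hDs : D ≤ s := hn₂ n hn₂'
  have hs2 : 2 * (C₁ + 1) ≤ s := by
    rw [hs, Nat.le_sqrt]
    nlinarith
  have hss : s * s ≤ n := Nat.sqrt_le n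
  have hfit2 : 2 * (D + C₁ * s) ≤ n := by nlinarith
  have hfit : D + C₁ * s ≤ n / 2 := by omega
  set D' := n / 2 - C₁ * s - D with hD'
  have hsum : D' + D = n / 2 - C₁ * s := by omega
  have ht : n / 2 - (C₁ * s + D) = D' := by omega
  have htle : C₁ * s + D ≤ (C₁ + 1) * s := by nlinarith
  -- the three inputs
  have hf : stratFun ch y ∈ fullSpan n D := stratFun_mem_fullSpan ch y hy
  have h₃ := hTB n D D' (stratFun ch y) hf
  rw [hsum] at h₃
  have h₄ := hmass n hm₀
  have h₅ := htail n hm₁ (C₁ * s + D) htle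
  rw [ht] at h₅
  -- combine
  set FAR := (farSet n (n / 2 - C₁ * s)).card with hFAR
  set N := numMonomials n D' with hN
  set FAIL := (failSetOf (stratFun ch y)).card with hFAIL
  have h2n : (0 : ℝ) < (2 : ℝ) ^ n := by positivity
  have h₃R : (FAR : ℝ) * N ≤ (2 : ℝ) ^ n * FAIL := by exact_mod_cast h₃
  have h₄R : (2 : ℝ) ^ n ≤ 2 * FAR := by exact_mod_cast h₄
  have hN0 : (0 : ℝ) ≤ N := Nat.cast_nonneg _
  have hfail : c / 2 * (2 : ℝ) ^ n ≤ FAIL := by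
    have step1 : (2 : ℝ) ^ n / 2 * (c * (2 : ℝ) ^ n) ≤ (FAR : ℝ) * N :=
      mul_le_mul (by linarith) h₅ (by positivity) (Nat.cast_nonneg _)
    have step2 : (2 : ℝ) ^ n * (c / 2 * (2 : ℝ) ^ n) ≤ (2 : ℝ) ^ n * FAIL := by
      calc (2 : ℝ) ^ n * (c / 2 * (2 : ℝ) ^ n) = (2 : ℝ) ^ n / 2 * (c * (2 : ℝ) ^ n) := by ring
        _ ≤ (FAR : ℝ) * N := step1
        _ ≤ (2 : ℝ) ^ n * FAIL := h₃R
    exact le_of_mul_le_mul_left step2 h2n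
  have hwin := card_win_add_card_failSetOf ch y
  have hwinR : ((univ.filter fun u : Fin n → Bool => ringWinU ch y u = true).card : ℝ) + FAIL =
      (2 : ℝ) ^ n := by
    rw [hFAIL]; exact_mod_cast hwin
  linarith

/-- Hence: `TubeMass → BinomTailLower → WalkHardAll` (the tube bound being proved). -/
theorem walkHardAll_of_tubeMass_of_binomTailLower (h₄ : TubeMass) (h₅ : BinomTailLower) :
    WalkHardAll :=
  tubePlan tubeBound h₄ h₅

end Summit.QuantumAdvantage.AdviceFreeQNC0

end
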